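import Summits.QuantumFields.YangMills.Theorems.BalabanUVNodesN11Sect3SupplyDefs

/-!
# DAG node N11 — DEFINITIONS for the SPLICED 𝐓-image witness: `graftAbove k t u` (old terms of `t` at the levels `≤ k`, the terms of `u` above), `zeroRB u` (keep only
# the 𝐄-component), `dropBFrom k t` (boundary terms cut off from level `k` on), and [III] §3's deliverable at level `k` in its MINIMAL form `Sect3SpliceSupplyAt θ p k`

HEADER — WORK-UNIT METADATA.  Cell `pub-ymgap`, YM-PLAN Track A (HUMAN RULING D-0062 ∕ D-0149), seat `pub-ymgap-dag-n11-e` (g15; R134 fan-out seat N11 [B14], strategy s3),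
route `BalabanUVNodes` rev 25 (v1.7 `CoPH` key), item K1⁷ `StabilityBAtRecordR13SepCoPH` = stmt-QuantumFields-20542; DEFINITION lane (`--supports 20542 --as helper`),
count-neutral.  [III] = [Balaban1988Convergent].  Over 11b ∕ 11c ∕ def-T v1.7 (`Node00.Sect2FrameOfRecord`, `Sect2FormOfRecord`, `Record13CoPH`) and this seat's
`…Sect3SupplyDefs` (p576857: `truncAbove`, `Sect3SupplyAt`, `NoExpansionTStepAt`).

WHY THIS FILE.  `Sect3SupplyAt θ p k` (p576857) asks a §3 supplier, for every exposed witness `(t, E_k)` of the §2 form of `ρ_k`, for a WHOLE candidate family `(tT, EkT)`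
over the histories of length `k+1`: (i) universal in 𝐄, (ii) with the no-expansion bookkeeping, (iii) with the 𝐓-image laws `Sect2.LawsT … k` AND the 𝐓-image clause at the
expansion histories.  Plan g77's W-SEAT-START-LIST §n11 asks this seat which pieces of the supply are unassigned — so the supply is cut to what print's §3 actually
produces: NEW TERMS AT LEVEL `k+1` (one history-free `𝐄^{(k+1)}`, and `𝐑^{(k+1)}`, `𝐁^{(k+1)}`, `E_{k+1}` per expansion history) obeying Theorem 2's clauses, and the identity
(3.67) `𝐓ρ_k = 𝐓_k exp A_{k+1}` for the witness SPLICED from the old terms and the new ones.  Everything else — universality, the no-expansion bookkeeping, the laws at the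
expansion children of ABSENT parents, and all old-level laws that the child's frame inherits from the parent's — is bookkeeping, discharged in the successor files
(`…Sect3SupplySpliceFrame` generic, `…Sect3SupplySplice` at the record).  ONE old-level law does NOT transfer (LOCATED-SPACEB, bus 2026-08-27 ≈23:10Z): 11b's (2.38) cube
family `Sect2.cubesMS M j Y Ω n` reads `Ω (n+2)` at the layer `n = j−1` (print p. 261 «□ ⊂ Ω_n∖Ω_{n+2}, □∩Ω^c_{n+1} ≠ ∅, n = 1, …, j−1», as printed), so the space `Ũ^c_k(X)` of the
OLD boundary term `𝐁^{(k)}` at an EXPANSION child `s′` (`Ω_{k+1}(s′) ≠ ∅`: fewer cubes, fewer constraints (ii)) is LARGER than at the parent (`Ω_{k+1}(init s′) = ∅`); the bound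
(2.42) and analyticity (2.41)(ii) of `𝐁^{(k)}` on it are therefore part of the supplier's list, displayed as (O1) below.

WHAT THIS FILE DEFINES (4 `def`: three term-value transformers + ONE `def … : Prop` naming a deliverable — NOT claimed inhabited; `rfl` ∕ `if_pos` ∕ `if_neg` faces; 0 `sorry`).
§1 `graftAbove k t u` · `zeroRB u` · `dropBFrom k t` + faces · `universalE_graftAbove`.
§2 `Sect3SpliceSupplyAt θ p k` — for every exposed witness `(t, E_k)`: ∃ `tnew` (universal in 𝐄) and `EkN` such that at every EXPANSION CHILD `s′` OF A PRESENT PARENT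
   (`Ω_{k+1}(s′) ≠ ∅`, `ρ_k(init s′) ≢ 0`): (O1) the old `𝐁^{(k)}` of `t (init s′)` obeys (2.42) ∕ (2.41)(ii) on the CHILD's `Ũ^c_k(X)` (void at `k = 0`); (O2) r11's new-term
   obligations `Step.LFNewTerms … k` and analyticity at `k+1` for `tnew s′` on the child's tower — [III] Thm 2's clauses for the supplier's OWN new terms; (O3) the 𝐓-image clause
   at `s′` for `(graftAbove k (t (init s′)) (tnew s′), EkN s′)` — [III] (3.67).

HONEST FRAMING.  Definitions and bookkeeping; `Sect3SpliceSupplyAt` is NOT claimed for any `θ`, run or level (it IS [III] Sect. 1 ∕ §3 ∕ Thm 2 at the objects of record,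
plus (O1)); nothing of Bałaban asserted; N11 NOT discharged; K1⁷ NOT closed; counts unmoved (typed 28∕28 · discharged 5∕27).  One finite `𝕋⁴_{L^K}` programme at fixed
`ε = L^{−K}`; NOT ℝ⁴, NOT OS, NOT a mass gap, NOT Clay.  No `sorry`, no `axiom`, no `instance`, no `notation`.
Sources: [III] Theorem p.245, §2 p.262, (2.23)–(2.28) pp.258–259, (2.30)–(2.31) p.260, (2.34)–(2.42) p.261, §3 p.279, (3.67) p.283.
-/

noncomputable section

open MeasureTheory
open scoped BigOperators Matrix.Norms.L2Operator

namespace Summit.QuantumFields.YangMills.Theorems.BalabanUVNodesN11Sect3SupplySpliceDefs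

open Literature.MathematicalPhysics.QuantumFieldTheory.Balaban1983to89 T4Continuum Node00 Node00.Tk
open Step B14.Eq227LocalizedTerms

/-! ## §1  Term-value transformers: graft above a level, keep only 𝐄, drop the boundary terms from a level on -/

section Transformers

variable {P : Params} {𝔸 : Type*} {V : Type*} {M : ℕ}

/-- **TERM VALUES GRAFTED ABOVE LEVEL `k`**: `𝐄 ∕ 𝐑 ∕ 𝐁` of `t` at the levels `j ≤ k`, of `u` at the levels `j > k` — the 𝐓-image witness at an expansion history: print keeps
the terms with `j ≤ k` («exactly as described above», §2 p. 262) and adds the new `𝐄^{(k+1)}, 𝐑^{(k+1)}, 𝐁^{(k+1)}` of §3. [cite: Balaban1988Convergent, §2 p.262, §3 p.279 (bookkeeping)] -/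
def graftAbove (k : ℕ) (t u : Sect2.TermValues P 𝔸 V M) : Sect2.TermValues P 𝔸 V M where
  E j X z g φ := if j ≤ k then t.E j X z g φ else u.E j X z g φ
  R j X φ := if j ≤ k then t.R j X φ else u.R j X φ
  B j X φ a := if j ≤ k then t.B j X φ a else u.B j X φ a

/-- **KEEP ONLY THE 𝐄-COMPONENT** (`𝐑 ∕ 𝐁` zero): the new-term source at a history WITHOUT new `𝐑^{(k+1)} ∕ 𝐁^{(k+1)}` (a no-expansion history, or an expansion child of an
absent parent) — the history-free `𝐄^{(k+1)}` must still be carried there ((2.25)–(2.27): the `𝐄`-terms have no history argument). [cite: Balaban1988Convergent, (2.25)–(2.27) p.259, (3.25) p.270 (bookkeeping)] -/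
def zeroRB (u : Sect2.TermValues P 𝔸 V M) : Sect2.TermValues P 𝔸 V M where
  E := u.E
  R _ _ _ := 0
  B _ _ _ _ := 0

/-- **DROP THE BOUNDARY TERMS FROM LEVEL `k` ON** (`𝐁^{(j)} := 0` for `j ≥ k`; `𝐄 ∕ 𝐑` unchanged): the old witness at an expansion child of an ABSENT parent (`ρ_k ≡ 0` there, so
its terms are immaterial; the level-`k` boundary term is cut so that no law is owed on the child's larger `Ũ^c_k(X)`). [cite: Balaban1988Convergent, (2.40)–(2.42) p.261 (bookkeeping)] -/
def dropBFrom (k : ℕ) (t : Sect2.TermValues P 𝔸 V M) : Sect2.TermValues P 𝔸 V M where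
  E := t.E
  R := t.R
  B j X φ a := if j < k then t.B j X φ a else 0

/-- The 𝐄-component of a graft, as a function (`rfl`). [cite: Balaban1988Convergent, (2.25) p.259 (bookkeeping)] -/
theorem graftAbove_E (k : ℕ) (t u : Sect2.TermValues P 𝔸 V M) :
    (graftAbove k t u).E = fun j X z g φ => if j ≤ k then t.E j X z g φ else u.E j X z g φ := rfl

/-- At the levels `≤ k` the graft has `t`'s `𝐄`. [cite: Balaban1988Convergent, §2 p.262 (bookkeeping)] -/
theorem graftAbove_E_of_le {k : ℕ} (t u : Sect2.TermValues P 𝔸 V M) {j : ℕ} (hj : j ≤ k) (X : (Sect2.domSys P M j).Dom) (z : Site P j) (g : ℝ)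
    (φ : Sect2.CPair P 𝔸) : (graftAbove k t u).E j X z g φ = t.E j X z g φ := if_pos hj

/-- At the levels `≤ k` the graft has `t`'s `𝐑`. [cite: Balaban1988Convergent, §2 p.262 (bookkeeping)] -/
theorem graftAbove_R_of_le {k : ℕ} (t u : Sect2.TermValues P 𝔸 V M) {j : ℕ} (hj : j ≤ k) (X : (Sect2.domSys P M j).Dom) (φ : Sect2.CPair P 𝔸) :
    (graftAbove k t u).R j X φ = t.R j X φ := if_pos hj

/-- At the levels `≤ k` the graft has `t`'s `𝐁`. [cite: Balaban1988Convergent, §2 p.262 (bookkeeping)] -/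
theorem graftAbove_B_of_le {k : ℕ} (t u : Sect2.TermValues P 𝔸 V M) {j : ℕ} (hj : j ≤ k) (X : (Sect2.domSys P M j).Dom) (φ : Sect2.CPair P 𝔸)
    (a : SFluct P V) : (graftAbove k t u).B j X φ a = t.B j X φ a := if_pos hj

/-- Above the level `k` the graft has `u`'s `𝐄`. [cite: Balaban1988Convergent, §3 p.279 (bookkeeping)] -/
theorem graftAbove_E_of_lt {k : ℕ} (t u : Sect2.TermValues P 𝔸 V M) {j : ℕ} (hj : k < j) (X : (Sect2.domSys P M j).Dom) (z : Site P j) (g : ℝ)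
    (φ : Sect2.CPair P 𝔸) : (graftAbove k t u).E j X z g φ = u.E j X z g φ := if_neg (Nat.not_le.mpr hj)

/-- Above the level `k` the graft has `u`'s `𝐑`. [cite: Balaban1988Convergent, §3 p.279 (bookkeeping)] -/
theorem graftAbove_R_of_lt {k : ℕ} (t u : Sect2.TermValues P 𝔸 V M) {j : ℕ} (hj : k < j) (X : (Sect2.domSys P M j).Dom) (φ : Sect2.CPair P 𝔸) :
    (graftAbove k t u).R j X φ = u.R j X φ := if_neg (Nat.not_le.mpr hj)

/-- Above the level `k` the graft has `u`'s `𝐁`. [cite: Balaban1988Convergent, §3 p.279 (bookkeeping)] -/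
theorem graftAbove_B_of_lt {k : ℕ} (t u : Sect2.TermValues P 𝔸 V M) {j : ℕ} (hj : k < j) (X : (Sect2.domSys P M j).Dom) (φ : Sect2.CPair P 𝔸)
    (a : SFluct P V) : (graftAbove k t u).B j X φ a = u.B j X φ a := if_neg (Nat.not_le.mpr hj)

/-- The level-`(k+1)` 𝐄 of a graft is the new source's, as a function. [cite: Balaban1988Convergent, §3 p.279 (bookkeeping)] -/
theorem graftAbove_E_succ (k : ℕ) (t u : Sect2.TermValues P 𝔸 V M) (X : (Sect2.domSys P M (k + 1)).Dom) (z : Site P (k + 1)) (g : ℝ) :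
    (graftAbove k t u).E (k + 1) X z g = u.E (k + 1) X z g :=
  funext fun φ => graftAbove_E_of_lt t u (Nat.lt_succ_self k) X z g φ

/-- The level-`(k+1)` 𝐑 of a graft is the new source's, as a function. [cite: Balaban1988Convergent, §3 p.279 (bookkeeping)] -/
theorem graftAbove_R_succ (k : ℕ) (t u : Sect2.TermValues P 𝔸 V M) (X : (Sect2.domSys P M (k + 1)).Dom) :
    (graftAbove k t u).R (k + 1) X = u.R (k + 1) X :=
  funext fun φ => graftAbove_R_of_lt t u (Nat.lt_succ_self k) X φ

/-- The level-`(k+1)` 𝐁 of a graft is the new source's, as a function of the configuration. [cite: Balaban1988Convergent, §3 p.279 (bookkeeping)] -/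
theorem graftAbove_B_succ (k : ℕ) (t u : Sect2.TermValues P 𝔸 V M) (X : (Sect2.domSys P M (k + 1)).Dom) (a : SFluct P V) :
    (fun φ => (graftAbove k t u).B (k + 1) X φ a) = fun φ => u.B (k + 1) X φ a :=
  funext fun φ => graftAbove_B_of_lt t u (Nat.lt_succ_self k) X φ a

/-- `zeroRB` keeps `𝐄` (`rfl`). [cite: Balaban1988Convergent, (2.25) p.259 (bookkeeping)] -/
theorem zeroRB_E (u : Sect2.TermValues P 𝔸 V M) : (zeroRB u).E = u.E := rfl

/-- `zeroRB` has no `𝐑` (`rfl`). [cite: Balaban1988Convergent, (2.30) p.260 (bookkeeping)] -/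
theorem zeroRB_R (u : Sect2.TermValues P 𝔸 V M) (j : ℕ) (X : (Sect2.domSys P M j).Dom) (φ : Sect2.CPair P 𝔸) : (zeroRB u).R j X φ = 0 := rfl

/-- `zeroRB` has no `𝐁` (`rfl`). [cite: Balaban1988Convergent, (2.40) p.261 (bookkeeping)] -/
theorem zeroRB_B (u : Sect2.TermValues P 𝔸 V M) (j : ℕ) (X : (Sect2.domSys P M j).Dom) (φ : Sect2.CPair P 𝔸) (a : SFluct P V) :
    (zeroRB u).B j X φ a = 0 := rfl

/-- `dropBFrom` keeps `𝐄` (`rfl`). [cite: Balaban1988Convergent, (2.25) p.259 (bookkeeping)] -/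
theorem dropBFrom_E (k : ℕ) (t : Sect2.TermValues P 𝔸 V M) : (dropBFrom k t).E = t.E := rfl

/-- `dropBFrom` keeps `𝐑` (`rfl`). [cite: Balaban1988Convergent, (2.30) p.260 (bookkeeping)] -/
theorem dropBFrom_R (k : ℕ) (t : Sect2.TermValues P 𝔸 V M) : (dropBFrom k t).R = t.R := rfl

/-- Below the level `k`, `dropBFrom k` keeps `𝐁`. [cite: Balaban1988Convergent, (2.40) p.261 (bookkeeping)] -/
theorem dropBFrom_B_of_lt {k : ℕ} (t : Sect2.TermValues P 𝔸 V M) {j : ℕ} (hj : j < k) (X : (Sect2.domSys P M j).Dom) (φ : Sect2.CPair P 𝔸) (a : SFluct P V) :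
    (dropBFrom k t).B j X φ a = t.B j X φ a := if_pos hj

/-- From the level `k` on, `dropBFrom k` has no `𝐁`. [cite: Balaban1988Convergent, (2.40) p.261 (bookkeeping)] -/
theorem dropBFrom_B_of_le {k : ℕ} (t : Sect2.TermValues P 𝔸 V M) {j : ℕ} (hj : k ≤ j) (X : (Sect2.domSys P M j).Dom) (φ : Sect2.CPair P 𝔸) (a : SFluct P V) :
    (dropBFrom k t).B j X φ a = 0 := if_neg (Nat.not_lt.mpr hj)

/-- **UNIVERSALITY IN 𝐄 OF A GRAFTED FAMILY**: grafting, history by history, a universal family `t` (re-indexed along `f`, e.g. `init`) below `k` with a universal family `u` above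
`k` gives a universal family — whatever is done to the `𝐑 ∕ 𝐁`-components (`zeroRB`, `dropBFrom` do not touch `𝐄`). [cite: Balaban1988Convergent, (2.25)–(2.27) p.259 (bookkeeping)] -/
theorem universalE_graftAbove {ι κ : Type*} {t : ι → Sect2.TermValues P 𝔸 V M} {u : κ → Sect2.TermValues P 𝔸 V M} (ht : Sect2.UniversalE t)
    (hu : Sect2.UniversalE u) (k : ℕ) (f : κ → ι) (t' : κ → Sect2.TermValues P 𝔸 V M)
    (hE : ∀ i, (t' i).E = (graftAbove k (t (f i)) (u i)).E) : Sect2.UniversalE t' := by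
  intro i i'
  rw [hE i, hE i', graftAbove_E, graftAbove_E]
  funext j X z g φ
  rw [ht (f i) (f i'), hu i i']

end Transformers

/-! ## §2  [III] §3's deliverable at level `k`, MINIMAL form -/

section Supply

variable {F : T4Family} {N : ℕ} [NeZero N]

/-- **[III] §3's DELIVERABLE AT LEVEL `k`, MINIMAL FORM** for the run `p` at the v1.7 parameter `θ` (the run's own `θ.rzAt p` ∕ `WtOfRecord₁₃H θ p`): for EVERY exposed witness
`(t, E_k)` of the §2 form of `ρ_k` (`HasSect2FormAtZS` at the inductive assumptions — the unfolding of `SLaw₁₃CoPH θ p k`), NEW TERM VALUES `tnew s′` per history `s′` of length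
`k+1`, UNIVERSAL in their 𝐄-component (ONE function `𝐄^{(k+1)}(X, ·, z)`; only the levels `≥ k+1` of `tnew` are ever read), and constants `EkN s′`, such that AT EVERY EXPANSION
CHILD `s′` OF A PRESENT PARENT (`Ω_{k+1}(s′) ≠ ∅` and `ρ_k(init s′) ≢ 0`):
(O1) the OLD boundary term `𝐁^{(k)}` of `t (init s′)` obeys the bound (2.42) and the analyticity (2.41)(ii) on the CHILD's space `Ũ^c_k(X)` (11b's `spaceB k X` along `s′` —
     larger than the parent's, LOCATED-SPACEB; void at `k = 0`);
(O2) the NEW terms obey r11's new-term obligations `Step.LFNewTerms … k` on the child's tower of record ((2.27)(i),(iii) for `𝐄^{(k+1)}, 𝐑^{(k+1)}`, the IMPROVED bounds of p. 262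
     for `𝐄^{(k+1)}, 𝐑^{(k+1)}, 𝐁^{(k+1)}`, the RG equation at `k` — a theorem of record, `settingOfRecord₁₃_satisfiesRG`) and are analytic at `k+1` ((2.27)(ii), (2.30),
     (2.41)(ii)) — [III] THEOREM 2's clauses for the supplier's own terms;
(O3) the 𝐓-IMAGE CLAUSE at `s′` for the SPLICED witness `graftAbove k (t (init s′)) (tnew s′)` with the constant `EkN s′`: `𝐓ρ_k(s′) ≡ 0`, or `𝐓ρ_k(s′) = 𝐓_k(s′)[W(s′)]
     exp A_{k+1}(s′)` a.e. on the support of `χ_{k+1}(s′)` — [III] (3.67) ∕ §3.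
A PREDICATE WITH PARAMETERS naming a deliverable — NOT claimed for any `θ`; `…Sect3SupplySplice.sect3SupplyAt_of_spliceSupply` shows it implies `Sect3SupplyAt θ p k`.
[cite: Balaban1988Convergent, Theorem p.245, Thm 2 p.263, §2 p.262, §3 p.279, (3.67) p.283, (2.27)–(2.28) p.259, (2.30)–(2.31) p.260, (2.38)–(2.42) p.261, (2.17)–(2.18) p.257] -/
def Sect3SpliceSupplyAt (θ : Stage13HParams F N) (p : B12.RunParams) (k : ℕ) : Prop :=
  ∀ (t : SeqOfRecord F θ.ν θ.τ9.M (gOfRecord₁₃ F N θ.toStage13Params p) p.K k → Sect2.TermValues (F.P p.K) (MatA N) (FluctV N) θ.τ9.M) (Ek : SeqOfRecord F θ.ν θ.τ9.M (gOfRecord₁₃ F N θ.toStage13Params p) p.K k → ℝ),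
    HasSect2FormAtZS F N (FluctV N) p.K (settingOfRecord₁₃ F N θ.toStage13Params p) k (θ.rzAt p) (WtOfRecord₁₃H F N θ p) (UbgOfRecord₁₃CoP F N θ.toStage13Params p k)
      (fun s u => Sect2.LawsRT (sect2TowerOfRecord F N (FluctV N) p.K (settingOfRecord₁₃ F N θ.toStage13Params p) (θ.rzAt p s) s u) (settingOfRecord₁₃ F N θ.toStage13Params p).lf k)
      (slotsOfRecord F N θ.ν θ.τ9 (EOfRecord₁₃ F N θ.toStage13Params) (wOfRecord₉ F N θ.toStage9Params) θ.ppSel p (gOfRecord₁₃ F N θ.toStage13Params p) k) t Ek →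
    ∃ (tnew : SeqOfRecord F θ.ν θ.τ9.M (gOfRecord₁₃ F N θ.toStage13Params p) p.K (k + 1) → Sect2.TermValues (F.P p.K) (MatA N) (FluctV N) θ.τ9.M) (EkN : SeqOfRecord F θ.ν θ.τ9.M (gOfRecord₁₃ F N θ.toStage13Params p) p.K (k + 1) → ℝ),
      Sect2.UniversalE tnew ∧
      ∀ s : SeqOfRecord F θ.ν θ.τ9.M (gOfRecord₁₃ F N θ.toStage13Params p) p.K (k + 1), s.Ω (k + 1) ≠ ∅ →
        slotsOfRecord F N θ.ν θ.τ9 (EOfRecord₁₃ F N θ.toStage13Params) (wOfRecord₉ F N θ.toStage9Params) θ.ppSel p (gOfRecord₁₃ F N θ.toStage13Params p) k s.init ≠ 0 →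
        -- (O1) the old boundary term `𝐁^{(k)}` on the CHILD's space `Ũ^c_k(X)`
        (1 ≤ k →
          (∀ (X : (Sect2.domSys (F.P p.K) θ.τ9.M k).Dom) (φ : Sect2.CPair (F.P p.K) (MatA N)) (a : SFluct (F.P p.K) (FluctV N)),
            φ ∈ (sect2TowerOfRecord F N (FluctV N) p.K (settingOfRecord₁₃ F N θ.toStage13Params p) (θ.rzAt p s) s (t s.init)).spaceB k X →
              ‖(t s.init).B k X φ a‖ ≤ (settingOfRecord₁₃ F N θ.toStage13Params p).lf.B₀ * Real.exp (-(settingOfRecord₁₃ F N θ.toStage13Params p).lf.κ * (Sect2.domSys (F.P p.K) θ.τ9.M k).dj X)) ∧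
          (∀ (X : (Sect2.domSys (F.P p.K) θ.τ9.M k).Dom) (a : SFluct (F.P p.K) (FluctV N)),
            AnalyticOnNhd ℂ (fun φ => (t s.init).B k X φ a)
              ((sect2TowerOfRecord F N (FluctV N) p.K (settingOfRecord₁₃ F N θ.toStage13Params p) (θ.rzAt p s) s (t s.init)).spaceB k X))) ∧
        -- (O2) the new terms: r11's new-term obligations and analyticity at `k+1`
        Step.LFNewTerms (sect2TowerOfRecord F N (FluctV N) p.K (settingOfRecord₁₃ F N θ.toStage13Params p) (θ.rzAt p s) s (tnew s))
          (settingOfRecord₁₃ F N θ.toStage13Params p).lf (settingOfRecord₁₃ F N θ.toStage13Params p).βc k ∧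
        (∀ (X : (Sect2.domSys (F.P p.K) θ.τ9.M (k + 1)).Dom) (z : Site (F.P p.K) (k + 1)) (g : ℝ), 0 ≤ g → g ≤ (settingOfRecord₁₃ F N θ.toStage13Params p).lf.γ →
          AnalyticOnNhd ℂ ((tnew s).E (k + 1) X z g)
            ((sect2TowerOfRecord F N (FluctV N) p.K (settingOfRecord₁₃ F N θ.toStage13Params p) (θ.rzAt p s) s (tnew s)).space (k + 1) X
              ((settingOfRecord₁₃ F N θ.toStage13Params p).lf.alpha0 ((settingOfRecord₁₃ F N θ.toStage13Params p).flow.g (k + 1)))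
              ((settingOfRecord₁₃ F N θ.toStage13Params p).lf.alpha1 ((settingOfRecord₁₃ F N θ.toStage13Params p).flow.g (k + 1))))) ∧
        (∀ X : (Sect2.domSys (F.P p.K) θ.τ9.M (k + 1)).Dom,
          AnalyticOnNhd ℂ ((tnew s).R (k + 1) X)
            ((sect2TowerOfRecord F N (FluctV N) p.K (settingOfRecord₁₃ F N θ.toStage13Params p) (θ.rzAt p s) s (tnew s)).space (k + 1) X
              ((settingOfRecord₁₃ F N θ.toStage13Params p).lf.alpha0 ((settingOfRecord₁₃ F N θ.toStage13Params p).flow.g (k + 1)))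
              ((settingOfRecord₁₃ F N θ.toStage13Params p).lf.alpha1 ((settingOfRecord₁₃ F N θ.toStage13Params p).flow.g (k + 1))))) ∧
        (∀ (X : (Sect2.domSys (F.P p.K) θ.τ9.M (k + 1)).Dom) (a : SFluct (F.P p.K) (FluctV N)),
          AnalyticOnNhd ℂ (fun φ => (tnew s).B (k + 1) X φ a)
            ((sect2TowerOfRecord F N (FluctV N) p.K (settingOfRecord₁₃ F N θ.toStage13Params p) (θ.rzAt p s) s (tnew s)).spaceB (k + 1) X)) ∧
        -- (O3) the 𝐓-image clause for the spliced witness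
        (slotsTOfRecord F N θ.ν θ.τ9 (EOfRecord₁₃ F N θ.toStage13Params) (wOfRecord₉ F N θ.toStage9Params) θ.ppSel p
            (gOfRecord₁₃ F N θ.toStage13Params p) (k + 1) s = 0 ∨
          ∀ᵐ V' ∂fieldMeasure (F.P p.K) (k + 1) (SU N),
            chiSeqOfRecord F N θ.ν θ.τ9.M (gOfRecord₁₃ F N θ.toStage13Params p) p.K (k + 1) s V' ≠ 0 →
              slotsTOfRecord F N θ.ν θ.τ9 (EOfRecord₁₃ F N θ.toStage13Params) (wOfRecord₉ F N θ.toStage9Params) θ.ppSel p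
                  (gOfRecord₁₃ F N θ.toStage13Params p) (k + 1) s V' =
                sect2Slot F N (FluctV N) p.K (settingOfRecord₁₃ F N θ.toStage13Params p) (θ.rzAt p s) (WtOfRecord₁₃H F N θ p s) s
                  (graftAbove k (t s.init) (tnew s)) (EkN s) (UbgOfRecord₁₃CoP F N θ.toStage13Params p (k + 1) s) V')

end Supply

end Summit.QuantumFields.YangMills.Theorems.BalabanUVNodesN11Sect3SupplySpliceDefs

end
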